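import Literature.NumberTheory.LFunctions.HardyZExtremaCriterionProofs
import Literature.NumberTheory.LFunctions.ZetaArgBacklundExplicit
import Literature.NumberTheory.LFunctions.HardyZSignParity
import Literature.NumberTheory.LFunctions.TuringMethod
import HarnessLib

/-!
# SigmaL / BC5 rung W0 — the LOCAL, RH-free, effective Ivić theorem (`Z'/Z` decreasing near on-line zeros)

Route `RiemannHypothesis/HardyZLehmerSplit`, item `SigmaL` (stmt-RiemannHypothesis-24253), tribunal seat
`rh-trib-w-sigmaL-1`. Re-filed sorry-free from the crux workfile `Cruxes/SigmaL/Lines/rung.lean` §0–§3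
(commit 08d91a8805b9, same seat g0) so that the BC5 rung `SigmaL_rung_W0` (`Theorems/SigmaLRungW0.lean`)
can be assembled in the Theorems lane. NOTHING HERE PROVES OR ASSUMES THE RIEMANN HYPOTHESIS; nothing
here bears on the truth of RH.

`SigmaL` says: for every `t > 3·10¹²`, a local minimum of Hardy's `Z` at `t` has `Z(t) ≤ 0` and a local
maximum has `Z(t) ≥ 0`. In print only RH ⟹ Σ_L is known (Ivić 2003 §2 Prop. 1, INEFFECTIVE `t₀`). Here:

* (the statement shapes of the workfile — `NoViolationOn`, `OnLineBetween`, `CriticalZeroWithin` — are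
  spelled out inline here, no new `def`s);
* §1 algebra of one zero term `φ_d(u) = u/(d + u²)`;
* §2 the zero sum for `Z'/Z`, RH-free (`pairTerm`, `hasSum_pairTerm`, `tsum_decrement_local`);
* §3 `localIvic` — if every zero of `ζ` with ordinate in `(A − ½, B + ½)` lies on the critical line and
  every `t ∈ (A, B)` has a critical zero in `(t, t + C₀]`, `A > 4C₀²`, then `Z'/Z` is strictly
  decreasing on every zero-free subinterval of `(A, B)` (off-window zeros may be anywhere in the strip).

References: Ivić 2003 §2 Prop. 1 (arXiv:math/0311162) [Ivic2003]; Edwards 1974 §8.3 [Edwards1974].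
-/

noncomputable section

set_option linter.dupNamespace false
set_option autoImplicit false

open Complex Filter Set
open scoped Real Topology ComplexConjugate
open Literature.NumberTheory.LFunctions

namespace Summit.RiemannHypothesis.RiemannHypothesis.Theorems.SigmaLRung

/-! ## §1. Algebra of one zero term `φ_d(u) = u/(d + u²)` (`d = (β − ½)²`, `u = t ∓ γ`) -/

/-- `−Im (1/z) = Im z/(Re z² + Im z²)` (both sides `0` at `z = 0`). [folklore] -/
theorem neg_im_one_div (z : ℂ) : -(1 / z).im = z.im / (z.re ^ 2 + z.im ^ 2) := by
  rw [one_div, Complex.inv_im, neg_div, neg_neg, Complex.normSq_apply]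
  congr 1
  ring

/-- `φ_d(u₁) − φ_d(u₂) = (u₂−u₁)(u₁u₂−d)/((d+u₁²)(d+u₂²))`. [folklore] -/
theorem phi_sub_eq {d u₁ u₂ : ℝ} (h₁ : d + u₁ ^ 2 ≠ 0) (h₂ : d + u₂ ^ 2 ≠ 0) :
    u₁ / (d + u₁ ^ 2) - u₂ / (d + u₂ ^ 2) =
      (u₂ - u₁) * (u₁ * u₂ - d) / ((d + u₁ ^ 2) * (d + u₂ ^ 2)) := by
  field_simp
  ring

/-- `φ_d` decreases from `u₁` to `u₂` (`u₁ ≤ u₂`) as soon as `u₁u₂ > d ≥ 0`: the term of a zero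
`β + iγ` in `Z'/Z` decreases on `[t₁, t₂]` when `(t₁−γ)(t₂−γ) > (β−½)²`. [folklore] -/
theorem phi_sub_nonneg {d u₁ u₂ : ℝ} (hd : 0 ≤ d) (hprod : d < u₁ * u₂) (h12 : u₁ ≤ u₂) :
    0 ≤ u₁ / (d + u₁ ^ 2) - u₂ / (d + u₂ ^ 2) := by
  have hu₁ : u₁ ≠ 0 := by rintro rfl; simp at hprod; linarith
  have hu₂ : u₂ ≠ 0 := by rintro rfl; simp at hprod; linarith
  have hsq₁ : 0 < u₁ ^ 2 := by positivity
  have hsq₂ : 0 < u₂ ^ 2 := by positivity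
  have h₁ : 0 < d + u₁ ^ 2 := by linarith
  have h₂ : 0 < d + u₂ ^ 2 := by linarith
  rw [phi_sub_eq h₁.ne' h₂.ne']
  exact div_nonneg (mul_nonneg (by linarith) (by linarith)) (by positivity)

/-- On the line (`d = 0`) the term is `1/u`. [folklore] -/
theorem phi_zero (u : ℝ) : u / ((1 / 2 - 1 / 2 : ℝ) ^ 2 + u ^ 2) = 1 / u := by
  have e : (1 / 2 - 1 / 2 : ℝ) ^ 2 + u ^ 2 = u * u := by ring
  rw [e]
  rcases eq_or_ne u 0 with rfl | hu
  · simp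
  · rw [← div_div, div_self hu]

/-- `1/(t₁−γ) − 1/(t₂−γ) = (t₂−t₁)/((t₁−γ)(t₂−γ))` when `(t₁−γ)(t₂−γ) ≠ 0`. [folklore] -/
theorem one_div_sub_one_div_eq {t₁ t₂ γ : ℝ} (h : (t₁ - γ) * (t₂ - γ) ≠ 0) :
    1 / (t₁ - γ) - 1 / (t₂ - γ) = (t₂ - t₁) / ((t₁ - γ) * (t₂ - γ)) := by
  have h1 : t₁ - γ ≠ 0 := fun e ↦ h (by rw [e, zero_mul])
  have h2 : t₂ - γ ≠ 0 := fun e ↦ h (by rw [e, mul_zero])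
  field_simp
  ring

/-- For `t₁ ≤ t₂` on the same side of `γ`: `1/(t₁−γ) − 1/(t₂−γ) ≥ 0`. [folklore] -/
theorem one_div_sub_one_div_nonneg {t₁ t₂ γ : ℝ} (h : 0 < (t₁ - γ) * (t₂ - γ))
    (h12 : t₁ ≤ t₂) : 0 ≤ 1 / (t₁ - γ) - 1 / (t₂ - γ) := by
  rw [one_div_sub_one_div_eq h.ne']
  exact div_nonneg (by linarith) h.le

/-- If `(t₁ − γ)(t₂ − γ) ≤ 0` and `t₁ ≤ t₂` then `γ ∈ [t₁, t₂]`. [folklore] -/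
theorem mem_Icc_of_mul_nonpos {t₁ t₂ γ : ℝ} (h : (t₁ - γ) * (t₂ - γ) ≤ 0) (h12 : t₁ ≤ t₂) :
    γ ∈ Icc t₁ t₂ := by
  rcases mul_nonpos_iff.1 h with ⟨h1, h2⟩ | ⟨h1, h2⟩
  · constructor <;> nlinarith
  · constructor <;> linarith

/-! ## §2. The zero sum for `Z'/Z`, RH-free: `−Im ξ'/ξ(½+it) = Σₙ −Im[1/(s−ρₙ) + 1/(s−(1−ρₙ))]` -/

variable {b : ℕ → ℂ}

/-- The real pair term `−Im [1/(s−ρₙ) + 1/(s−(1−ρₙ))]` at `s = ½ + it` (padding indices read `0`). -/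
def pairTerm (b : ℕ → ℂ) (n : ℕ) (t : ℝ) : ℝ :=
  -((if b n = 0 then (0 : ℂ) else
      1 / ((1 / 2 : ℂ) + (t : ℂ) * I - IsHadamardSeq.xiZero b n) +
        1 / ((1 / 2 : ℂ) + (t : ℂ) * I - (1 - IsHadamardSeq.xiZero b n))).im)

/-- **Ivić (2.1) on the critical line, RH-FREE.** For a Hadamard sequence `b` of `ξ` and
`s = ½ + it` with `ξ(s) ≠ 0`, `Σₙ pairTerm b n t = −Im ξ'/ξ(s)` (the tree's grouped Hadamard
series `IsHadamardSeq.logDeriv_riemannXi_eq_tsum_pairs`, imaginary parts). -/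
theorem hasSum_pairTerm (h : IsHadamardSeq 0 b) {t : ℝ}
    (hξ : riemannXi ((1 / 2 : ℂ) + (t : ℂ) * I) ≠ 0) :
    HasSum (fun n ↦ pairTerm b n t) (-(logDeriv riemannXi ((1 / 2 : ℂ) + (t : ℂ) * I)).im) := by
  have hS := (Complex.hasSum_im (h.summable_pairs hξ).hasSum).neg
  rw [← h.logDeriv_riemannXi_eq_tsum_pairs hξ] at hS
  exact hS.congr_fun fun n ↦ rfl

/-- The pair term written out: with `ρₙ = β + iγ`,
`pairTerm = (t−γ)/((½−β)² + (t−γ)²) + (t+γ)/((½−β)² + (t+γ)²)`. [folklore] -/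
theorem pairTerm_eq {n : ℕ} (hn : b n ≠ 0) (t : ℝ) :
    pairTerm b n t =
      (t - (IsHadamardSeq.xiZero b n).im) /
          ((1 / 2 - (IsHadamardSeq.xiZero b n).re) ^ 2 + (t - (IsHadamardSeq.xiZero b n).im) ^ 2) +
        (t + (IsHadamardSeq.xiZero b n).im) /
          ((1 / 2 - (IsHadamardSeq.xiZero b n).re) ^ 2 + (t + (IsHadamardSeq.xiZero b n).im) ^ 2) := by
  unfold pairTerm
  rw [if_neg hn, Complex.add_im, neg_add, neg_im_one_div, neg_im_one_div]
  have hre1 : ((1 / 2 : ℂ) + (t : ℂ) * I - IsHadamardSeq.xiZero b n).re =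
      1 / 2 - (IsHadamardSeq.xiZero b n).re := by simp
  have him1 : ((1 / 2 : ℂ) + (t : ℂ) * I - IsHadamardSeq.xiZero b n).im =
      t - (IsHadamardSeq.xiZero b n).im := by simp
  have hre2 : ((1 / 2 : ℂ) + (t : ℂ) * I - (1 - IsHadamardSeq.xiZero b n)).re =
      -(1 / 2 - (IsHadamardSeq.xiZero b n).re) := by simp; ring
  have him2 : ((1 / 2 : ℂ) + (t : ℂ) * I - (1 - IsHadamardSeq.xiZero b n)).im =
      t + (IsHadamardSeq.xiZero b n).im := by simp
  rw [hre1, him1, hre2, him2, neg_sq]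

/-- **Every pair term decreases across `[t₁, t₂]`** when `ζ(½+iu) ≠ 0` on `[t₁, t₂]` and the
zeros with ordinate in `(A', B') ⊇ (t₁ − ½, t₂ + ½)` are on the line: an on-line zero has its
poles `±γ` outside `[t₁, t₂]`; an off-line zero `β ± iγ` has `|γ|` at distance `≥ ½ > |β − ½|` from
`[t₁, t₂]`, so `(t₁∓γ)(t₂∓γ) ≥ ¼ > (β−½)²`. RH-free. -/
theorem pairTerm_sub_nonneg (h : IsHadamardSeq 0 b) (n : ℕ) {t₁ t₂ A' B' : ℝ} (hlt : t₁ < t₂)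
    (hZ : ∀ u ∈ Icc t₁ t₂, riemannZeta (1 / 2 + (u : ℂ) * I) ≠ 0)
    (hA' : A' ≤ t₁ - 1 / 2) (hB' : t₂ + 1 / 2 ≤ B') (hline : ∀ s : ℂ, riemannZeta s = 0 → A' < s.im → s.im < B' → s.re = 1 / 2) :
    0 ≤ pairTerm b n t₁ - pairTerm b n t₂ := by
  by_cases hn : b n = 0
  · simp [pairTerm, hn]
  obtain ⟨hζ, h0, h1⟩ := h.riemannZeta_xiZero hn
  rw [pairTerm_eq hn, pairTerm_eq hn]
  set ρ : ℂ := IsHadamardSeq.xiZero b n with hρdef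
  set β : ℝ := ρ.re with hβdef
  set γ : ℝ := ρ.im with hγdef
  have hd0 : 0 ≤ (1 / 2 - β) ^ 2 := sq_nonneg _
  have hd4 : (1 / 2 - β) ^ 2 < 1 / 4 := by nlinarith
  have hρeq : ρ = (β : ℂ) + (γ : ℂ) * I := by
    apply Complex.ext <;> simp [hβdef, hγdef]
  -- the conjugate zero `β − iγ`
  have hζc : riemannZeta ((β : ℂ) + ((-γ : ℝ) : ℂ) * I) = 0 := by
    have e : (starRingEnd ℂ) ρ = (β : ℂ) + ((-γ : ℝ) : ℂ) * I := by
      apply Complex.ext <;> simp [hβdef, hγdef]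
    rw [← e, riemannZeta_conj, hζ, map_zero]
  -- first summand: `(½−β)² < (t₁ − γ)(t₂ − γ)`
  have h1st : (1 / 2 - β) ^ 2 < (t₁ - γ) * (t₂ - γ) := by
    by_cases hβ : β = 1 / 2
    · have hd : (1 / 2 - β) ^ 2 = 0 := by rw [hβ]; norm_num
      rw [hd]
      by_contra hle
      push Not at hle
      obtain ⟨hl, hr⟩ := mem_Icc_of_mul_nonpos hle hlt.le
      refine hZ γ ⟨hl, hr⟩ ?_
      have e : (1 / 2 : ℂ) + (γ : ℂ) * I = ρ := by
        rw [hρeq, hβ]; push_cast; ring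
      rw [e]; exact hζ
    · have hγout : γ ≤ A' ∨ B' ≤ γ := by
        by_contra hin
        push Not at hin
        exact hβ (hline ρ hζ hin.1 hin.2)
      rcases hγout with hγA | hγB
      · have a1 : 1 / 2 ≤ t₁ - γ := by linarith
        have a2 : 1 / 2 ≤ t₂ - γ := by linarith
        have := mul_le_mul a1 a2 (by norm_num) (by linarith)
        linarith
      · have a1 : 1 / 2 ≤ γ - t₂ := by linarith
        have a2 : 1 / 2 ≤ γ - t₁ := by linarith
        have := mul_le_mul a2 a1 (by norm_num) (by linarith)
        have e : (t₁ - γ) * (t₂ - γ) = (γ - t₁) * (γ - t₂) := by ring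
        linarith
  -- second summand: `(½−β)² < (t₁ + γ)(t₂ + γ)` (the pole `−γ` of the partner / conjugate)
  have h2nd : (1 / 2 - β) ^ 2 < (t₁ + γ) * (t₂ + γ) := by
    by_cases hβ : β = 1 / 2
    · have hd : (1 / 2 - β) ^ 2 = 0 := by rw [hβ]; norm_num
      rw [hd]
      by_contra hle
      push Not at hle
      have hle' : (t₁ - -γ) * (t₂ - -γ) ≤ 0 := by
        have e : (t₁ - -γ) * (t₂ - -γ) = (t₁ + γ) * (t₂ + γ) := by ring
        rw [e]; exact hle
      obtain ⟨hl, hr⟩ := mem_Icc_of_mul_nonpos hle' hlt.le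
      refine hZ (-γ) ⟨hl, hr⟩ ?_
      have e : (1 / 2 : ℂ) + ((-γ : ℝ) : ℂ) * I = (β : ℂ) + ((-γ : ℝ) : ℂ) * I := by
        rw [hβ]; push_cast; ring
      rw [e]; exact hζc
    · have hγout : -γ ≤ A' ∨ B' ≤ -γ := by
        by_contra hin
        push Not at hin
        have hre : ((β : ℂ) + ((-γ : ℝ) : ℂ) * I).re = 1 / 2 :=
          hline _ hζc (by simpa using hin.1) (by simpa using hin.2)
        simp at hre
        exact hβ (by rw [hre]; norm_num)
      rcases hγout with hγA | hγB
      · have a1 : 1 / 2 ≤ t₁ + γ := by linarith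
        have a2 : 1 / 2 ≤ t₂ + γ := by linarith
        have := mul_le_mul a1 a2 (by norm_num) (by linarith)
        linarith
      · have a1 : 1 / 2 ≤ -γ - t₂ := by linarith
        have a2 : 1 / 2 ≤ -γ - t₁ := by linarith
        have := mul_le_mul a2 a1 (by norm_num) (by linarith)
        have e : (t₁ + γ) * (t₂ + γ) = (-γ - t₁) * (-γ - t₂) := by ring
        linarith
  have e1 := phi_sub_nonneg hd0 h1st (by linarith : t₁ - γ ≤ t₂ - γ)
  have e2 := phi_sub_nonneg hd0 h2nd (by linarith : t₁ + γ ≤ t₂ + γ)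
  linarith

/-- **The zero sum drops by at least `(t₂−t₁)/C₀²` across a zero-free `[t₁, t₂]`** when a
critical zero `γ` lies in `(t₁, t₁ + C₀]` (RH-free, local hypotheses as in
`pairTerm_sub_nonneg`): every term decreases and the term of `γ` alone loses
`(t₂−t₁)/((γ−t₁)(γ−t₂)) ≥ (t₂−t₁)/C₀²`. -/
theorem tsum_decrement_local (h : IsHadamardSeq 0 b) {a a' t₁ t₂ γ C₀ A' B' : ℝ} (ha : 0 ≤ a)
    (hfree : ∀ t ∈ Ioo a a', hardyZ t ≠ 0) (ht₁ : t₁ ∈ Ioo a a') (ht₂ : t₂ ∈ Ioo a a')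
    (hlt : t₁ < t₂) (hA' : A' ≤ t₁ - 1 / 2) (hB' : t₂ + 1 / 2 ≤ B') (hline : ∀ s : ℂ, riemannZeta s = 0 → A' < s.im → s.im < B' → s.re = 1 / 2)
    (hγζ : riemannZeta (1 / 2 + (γ : ℂ) * I) = 0) (hγ₁ : t₁ < γ) (hγC : γ ≤ t₁ + C₀) :
    (t₂ - t₁) / C₀ ^ 2 ≤ ∑' n, pairTerm b n t₁ - ∑' n, pairTerm b n t₂ := by
  have hZ : ∀ t ∈ Ioo a a', riemannZeta (1 / 2 + (t : ℂ) * I) ≠ 0 := fun t ht h0 ↦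
    hfree t ht ((hardyZ_eq_zero_iff_holds t).2 h0)
  have hγa' : a' ≤ γ := by
    by_contra hlt'
    exact hZ γ ⟨ht₁.1.trans hγ₁, not_le.1 hlt'⟩ hγζ
  have hγ₂ : t₂ < γ := ht₂.2.trans_le hγa'
  have hξ₁ : riemannXi ((1 / 2 : ℂ) + (t₁ : ℂ) * I) ≠ 0 := fun h0 ↦
    hZ t₁ ht₁ ((riemannXi_eq_zero_iff_holds _).1 h0).1
  have hξ₂ : riemannXi ((1 / 2 : ℂ) + (t₂ : ℂ) * I) ≠ 0 := fun h0 ↦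
    hZ t₂ ht₂ ((riemannXi_eq_zero_iff_holds _).1 h0).1
  have hsum₁ := (hasSum_pairTerm h hξ₁).summable
  have hsum₂ := (hasSum_pairTerm h hξ₂).summable
  rw [← hsum₁.tsum_sub hsum₂]
  have hZIcc : ∀ u ∈ Icc t₁ t₂, riemannZeta (1 / 2 + (u : ℂ) * I) ≠ 0 := fun u hu ↦
    hZ u ⟨ht₁.1.trans_le hu.1, hu.2.trans_lt ht₂.2⟩
  have hnonneg : ∀ n, 0 ≤ pairTerm b n t₁ - pairTerm b n t₂ := fun n ↦
    pairTerm_sub_nonneg h n hlt hZIcc hA' hB' hline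
  -- the index of the nearby critical zero
  have hξγ : riemannXi ((1 / 2 : ℂ) + (γ : ℂ) * I) = 0 :=
    (riemannXi_eq_zero_iff_holds _).2 ⟨hγζ, by simp, by norm_num⟩
  obtain ⟨n₀, hn₀, hcases⟩ := Ivic2003.exists_index_of_riemannXi_eq_zero h hξγ
  have hre : (IsHadamardSeq.xiZero b n₀).re = 1 / 2 := by
    rcases hcases with hc | hc
    · rw [← hc]; simp
    · have e : IsHadamardSeq.xiZero b n₀ = 1 - (1 / 2 + (γ : ℂ) * I) := by rw [hc]; ring
      rw [e]; simp; norm_num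
  have hγn : (IsHadamardSeq.xiZero b n₀).im = γ ∨ (IsHadamardSeq.xiZero b n₀).im = -γ := by
    rcases hcases with hc | hc
    · left; rw [← hc]; simp
    · right
      have e : IsHadamardSeq.xiZero b n₀ = 1 - (1 / 2 + (γ : ℂ) * I) := by rw [hc]; ring
      rw [e]; simp
  have hterm₀ : pairTerm b n₀ t₁ - pairTerm b n₀ t₂ =
      (1 / (t₁ - γ) - 1 / (t₂ - γ)) + (1 / (t₁ + γ) - 1 / (t₂ + γ)) := by
    rw [pairTerm_eq hn₀, pairTerm_eq hn₀, hre]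
    rcases hγn with hg | hg
    · rw [hg, phi_zero, phi_zero, phi_zero, phi_zero]
      ring
    · rw [hg]
      simp only [sub_neg_eq_add, ← sub_eq_add_neg]
      rw [phi_zero, phi_zero, phi_zero, phi_zero]
      ring
  have hC₀ : (t₁ - γ) * (t₂ - γ) ≤ C₀ ^ 2 := by
    have e : (t₁ - γ) * (t₂ - γ) = (γ - t₁) * (γ - t₂) := by ring
    rw [e, sq]
    exact mul_le_mul (by linarith) (by linarith) (by linarith) (by linarith)
  have hmain : (t₂ - t₁) / C₀ ^ 2 ≤ 1 / (t₁ - γ) - 1 / (t₂ - γ) := by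
    have hp : 0 < (t₁ - γ) * (t₂ - γ) := by nlinarith
    rw [one_div_sub_one_div_eq hp.ne']
    exact div_le_div_of_nonneg_left (by linarith) hp hC₀
  have hplus : 0 ≤ 1 / (t₁ + γ) - 1 / (t₂ + γ) := by
    have e : ∀ t : ℝ, t + γ = t - -γ := fun t ↦ by ring
    rw [e t₁, e t₂]
    refine one_div_sub_one_div_nonneg ?_ hlt.le
    have : 0 < t₁ := ha.trans_lt ht₁.1
    nlinarith
  have hterm : (t₂ - t₁) / C₀ ^ 2 ≤ pairTerm b n₀ t₁ - pairTerm b n₀ t₂ := by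
    rw [hterm₀]; linarith
  exact hterm.trans ((hsum₁.sub hsum₂).le_tsum n₀ fun j _ ↦ hnonneg j)

/-! ## §3. The local, effective Ivić theorem (RH-free) -/

/-- **LOCAL IVIĆ THEOREM (RH-free, effective).** If the zeros of `ζ` with ordinate in
`(A', B') ⊇ (A − ½, B + ½)` lie on the critical line, every `t ∈ (A, B)` has a critical zero in
`(t, t + C₀]`, `A ≥ 1` and `A > 4C₀²`, then `Z'/Z` is strictly decreasing on every zero-free
interval `(a, a') ⊆ [A, B]` of Hardy's `Z`. (Ivić's proof of Prop. 1 with the RH input replaced by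
the window hypothesis: `Z'/Z = Σₙ pairTerm − 2t/(t²+¼) + ½ Im ψ(¼+it/2)`; the zero sum drops by
`≥ (t₂−t₁)/C₀²` (`tsum_decrement_local`), the smooth part rises by `≤ 4(t₂−t₁)/t₁`
(`Ivic2003.corr_sub_le`), and `4/t₁ < 1/C₀²`.) Nothing here assumes or proves RH. -/
theorem localIvic {A B A' B' C₀ : ℝ} (hA1 : 1 ≤ A) (hAC : 4 * C₀ ^ 2 < A)
    (hA' : A' ≤ A - 1 / 2) (hB' : B + 1 / 2 ≤ B') (hline : ∀ s : ℂ, riemannZeta s = 0 → A' < s.im → s.im < B' → s.re = 1 / 2)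
    (hnear : ∀ t : ℝ, A < t → t < B → ∃ γ : ℝ, t < γ ∧ γ ≤ t + C₀ ∧ riemannZeta (1 / 2 + (γ : ℂ) * I) = 0) {a a' : ℝ} (ha : A ≤ a) (ha' : a' ≤ B)
    (hfree : ∀ t ∈ Ioo a a', hardyZ t ≠ 0) :
    StrictAntiOn (fun t ↦ deriv hardyZ t / hardyZ t) (Ioo a a') := by
  obtain ⟨d, hd⟩ := exists_isHadamardSeq 0
  intro t₁ ht₁ t₂ ht₂ hlt
  have hZ : ∀ t ∈ Ioo a a', riemannZeta (1 / 2 + (t : ℂ) * I) ≠ 0 := fun t ht h0 ↦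
    hfree t ht ((hardyZ_eq_zero_iff_holds t).2 h0)
  have hform : ∀ t ∈ Ioo a a', deriv hardyZ t / hardyZ t =
      (∑' n, pairTerm d n t) +
        (-(2 * t / (t ^ 2 + 1 / 4)) +
          (Complex.digamma ((1 / 4 : ℂ) + ((t / 2 : ℝ) : ℂ) * I)).im / 2) := by
    intro t ht
    have hξ : riemannXi ((1 / 2 : ℂ) + (t : ℂ) * I) ≠ 0 := fun h0 ↦
      hZ t ht ((riemannXi_eq_zero_iff_holds _).1 h0).1
    rw [Ivic2003.deriv_hardyZ_div_eq (hZ t ht), Ivic2003.neg_im_logDeriv_zeta_critPt (hZ t ht),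
      ← (hasSum_pairTerm hd hξ).tsum_eq]
    ring
  show deriv hardyZ t₂ / hardyZ t₂ < deriv hardyZ t₁ / hardyZ t₁
  rw [hform t₁ ht₁, hform t₂ ht₂]
  have hAt₁ : A < t₁ := lt_of_le_of_lt ha ht₁.1
  have ht₂B : t₂ < B := lt_of_lt_of_le ht₂.2 ha'
  obtain ⟨γ, hγ1, hγ2, hγζ⟩ := hnear t₁ hAt₁ (hlt.trans ht₂B)
  have hC₀ : 0 < C₀ := by linarith
  have hS := tsum_decrement_local hd (by linarith) hfree ht₁ ht₂ hlt (by linarith) (by linarith)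
    hline hγζ hγ1 hγ2
  have hc := Ivic2003.corr_sub_le (by linarith : (1 : ℝ) ≤ t₁) hlt.le
  have ht₁C : 4 * C₀ ^ 2 < t₁ := by linarith
  have ht₁0 : 0 < t₁ := by linarith
  have hgap : 4 * (t₂ - t₁) / t₁ < (t₂ - t₁) / C₀ ^ 2 := by
    rw [div_lt_div_iff₀ ht₁0 (by positivity)]
    nlinarith [mul_lt_mul_of_pos_left ht₁C (sub_pos.2 hlt)]
  linarith


end Summit.RiemannHypothesis.RiemannHypothesis.Theorems.SigmaLRung

end
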